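import Summits.BirchSwinnertonDyer.Rank1Residual.Additive.KatoDescentKummerUnramifiedLimit
import HarnessLib

set_option autoImplicit false

/-!
# (R1-d), THE PASSAGE `k → ∞` ON THE DISCRETE SIDE, II: the index `[S_Σ : Sel_{p^∞}]` is FINITE and is reached at a finite
# level — `[S_Σ ⊓ H¹(K,E[p^∞])[p^k] : Sel_{p^∞} ⊓ …] = [S_Σ : Sel_{p^∞} ⊓ S_Σ]` for `k ≫ 0` — hence
# `[S_Σ : Sel_{p^∞} ⊓ S_Σ] · [Sel^{(p^k)} : H¹_{𝓚⊓ur@Σ}(K, E[p^k])] = ∏_{v∈Σ} p^{v_p(c_v)}` for all large `k`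
# (seat `bsd-cm-prr-ty1` g11, cell `bsd-cm`; theorems only: no definition, no named fact, no instance, no `sorry`)

Part 27 of the seat's kernel cut of stub 3 `stub_rankOneCountReadingKato` of the Kato–Perrin-Riou skeletons v4 (cruxes
stmt-BirchSwinnertonDyer-19945 / -19223; = cell bsd-potss's held input 27322).  Sequel of Part 26 (`KatoDescentKummerUnramifiedLimit`:
`[S_Σ ⊓ im ι_k : Sel_{p^∞} ⊓ …] · [Sel^{(p^k)} : H¹_{𝓚⊓ur@Σ}] = ∏_{v∈Σ} p^{v_p(c_v)}` for `k ≫ 0`, `im ι_k = H¹(K, E[p^∞])[p^k]`).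

* §1 (pure algebra, any abelian group `X`, subgroups `A`, `B`, an exhausting monotone sequence `T k` of subgroups)
  **`relIndex_ne_zero_and_exists_forall_le_relIndex_inf_eq`** — if `[A ⊓ T_k : B ⊓ …] ≤ C` (and `≠ 0`) for all large `k`, then
  `[A : B ⊓ A]` is finite (`≠ 0`, `≤ C`) and `[A ⊓ T_k : B ⊓ …] = [A : B ⊓ A]` for all large `k` (the embeddings
  `(A ⊓ T_k)/B ↪ A/B`, Mathlib `AddSubgroup.quotientAddSubgroupOfEmbeddingOfLE`, are eventually onto any finite set of cosets).
* §2 `existsUnique_addSubgroup_mem_iff` — Kato's `S(T) = S_Σ` AS A TERM without a definition: the subgroup of `H¹(K, E[p^∞])`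
  cut out by «`p^∞`-Selmer local kernel off `Σ`, unramified at `Σ`» exists and is unique (an inf of local kernels and pulled-back
  unramified subgroups); `localization_mem_unramifiedSubgroup_of_mem_selmerLocalKerPrimary` — at an additive `v ∤ p`, `p` odd, the
  `p^∞`-Selmer local kernel is unramified; hence `selmerGroupPInfty_le_of_mem_iff`: **`Sel_{p^∞}(E/K) ≤ S_Σ`**;
  **`exists_forall_le_relIndex_selmerGroupPInfty_eq_and_mul_eq`** (`K : Type`, `p` odd, `Σ` additive places `∤ p`, `S_Σ` by
  its binder `hS` as in Part 26): `[S_Σ : Sel_{p^∞}(E/K)]` is finite, equals `[S_Σ ⊓ im ι_k : Sel_{p^∞} ⊓ …]` for `k ≫ 0`, and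
  **`[S_Σ : Sel_{p^∞}] · [Sel^{(p^k)}(E/K) : H¹_{𝓚⊓ur@Σ}(K, E[p^k])] = ∏_{v∈Σ} p^{v_p(c_v)}` for all large `k`** — so the
  second factor is CONSTANT for `k ≫ 0`; the potss memo's (R1-d) names it `p^a = [ℤ_p κ_∞(P) : 𝔥]` (the COMPACT side, Parts 19–21;
  its identification is NOT done here); `exists_addSubgroup_selmerGroupPInfty_le_and_relIndex_mul_eq` — the same with `S_Σ`
  bound by `∃` (self-contained reading).  `T k := im ι_k` exhausts `H¹(K, E[p^∞])` because every class is `p`-power torsion.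

HONEST LABEL: theorems only; no stub or item is closed; nothing is registered; nothing is asserted on 19945 / 19223;
Kato's Main Conjecture and Perrin-Riou's conjecture are not touched; BSD is not proved for any curve.

References: [Rubin2000] Thm. 1.7.3; [Kato2004Asterisque] §14.8 (p. 238), (14.9.3) (p. 240); [GreenbergLNM1716] §5 (p. 114);
[MilneADT2006] Ch. I Thm. 4.10.
-/

noncomputable section

open scoped Classical ContRepresentation NumberField
open Function Field NumberField IsDedekindDomain WeierstrassCurve
open Literature.NumberTheory.EllipticCurves Literature.NumberTheory.GaloisRepresentations
  Literature.NumberTheory.GaloisRepresentations.DiscreteGaloisModule Literature.NumberTheory.GaloisCohomology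
open Summit.BirchSwinnertonDyer.Rank1Residual.X11b.Levels Summit.BirchSwinnertonDyer.Rank1Residual.X11b.LocBridge

namespace Summit.BirchSwinnertonDyer.Rank1Residual.Additive.KummerUnramified

/-! ## §1 Indices along an exhausting sequence of subgroups -/

section Algebra

variable {X : Type*} [AddCommGroup X] (A B : AddSubgroup X) (T : ℕ → AddSubgroup X)

/-- Every finite set of cosets of `A / (B ⊓ A)` is reached from `A ⊓ T_k` for all large `k`, when `T` is monotone and
exhausts `X`. [folklore] -/
theorem exists_forall_le_subset_range_quotientEmbedding (hT : Monotone T) (hcov : ∀ x : X, ∃ k, x ∈ T k)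
    (F : Finset (A ⧸ B.addSubgroupOf A)) :
    ∃ k₀ : ℕ, ∀ k, k₀ ≤ k → ∀ f ∈ F,
      f ∈ Set.range (AddSubgroup.quotientAddSubgroupOfEmbeddingOfLE B (inf_le_left : A ⊓ T k ≤ A)) := by
  classical
  have hrep : ∀ f : A ⧸ B.addSubgroupOf A, ∃ k₀ : ℕ, ∀ k, k₀ ≤ k →
      f ∈ Set.range (AddSubgroup.quotientAddSubgroupOfEmbeddingOfLE B (inf_le_left : A ⊓ T k ≤ A)) := by
    intro f
    obtain ⟨a, rfl⟩ := QuotientAddGroup.mk_surjective f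
    obtain ⟨k₀, hk₀⟩ := hcov (a : X)
    refine ⟨k₀, fun k hk => ⟨QuotientAddGroup.mk ⟨(a : X), a.2, hT hk hk₀⟩, ?_⟩⟩
    rw [AddSubgroup.quotientAddSubgroupOfEmbeddingOfLE_apply_mk]
    rfl
  choose g hg using hrep
  exact ⟨F.sup g, fun k hk f hf => hg f k ((Finset.le_sup hf).trans hk)⟩

/-- A finite set of cosets reached from `A ⊓ T_k` has at most `[A ⊓ T_k : B ⊓ …]` elements (when that index is finite). [folklore] -/
theorem card_le_relIndex_inf_of_subset_range {k : ℕ} (F : Finset (A ⧸ B.addSubgroupOf A))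
    (hF : ∀ f ∈ F, f ∈ Set.range (AddSubgroup.quotientAddSubgroupOfEmbeddingOfLE B (inf_le_left : A ⊓ T k ≤ A)))
    (hk : B.relIndex (A ⊓ T k) ≠ 0) : F.card ≤ B.relIndex (A ⊓ T k) := by
  classical
  haveI : Finite ((A ⊓ T k : AddSubgroup X) ⧸ B.addSubgroupOf (A ⊓ T k)) := by
    by_contra h
    rw [not_finite_iff_infinite] at h
    exact hk (AddSubgroup.index_eq_zero_iff_infinite.2 h)
  haveI := Fintype.ofFinite ((A ⊓ T k : AddSubgroup X) ⧸ B.addSubgroupOf (A ⊓ T k))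
  rw [AddSubgroup.relIndex, AddSubgroup.index_eq_card, Nat.card_eq_fintype_card]
  have hsub : F ⊆ Finset.univ.map (AddSubgroup.quotientAddSubgroupOfEmbeddingOfLE B (inf_le_left : A ⊓ T k ≤ A)) := by
    intro f hf
    obtain ⟨y, hy⟩ := hF f hf
    exact Finset.mem_map.2 ⟨y, Finset.mem_univ _, hy⟩
  exact (Finset.card_le_card hsub).trans (by rw [Finset.card_map, Finset.card_univ])

/-- **Indices along an exhausting monotone sequence**: if `[A ⊓ T_k : B ⊓ …]` is finite and `≤ C` for all `k ≥ k₁`, then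
`[A : B ⊓ A]` is finite, `≤ C`, and equals `[A ⊓ T_k : B ⊓ …]` for all large `k`. [folklore] -/
theorem relIndex_ne_zero_and_exists_forall_le_relIndex_inf_eq (hT : Monotone T) (hcov : ∀ x : X, ∃ k, x ∈ T k)
    (C k₁ : ℕ) (hC : ∀ k, k₁ ≤ k → B.relIndex (A ⊓ T k) ≠ 0 ∧ B.relIndex (A ⊓ T k) ≤ C) :
    B.relIndex A ≠ 0 ∧ B.relIndex A ≤ C ∧ ∃ k₀ : ℕ, ∀ k, k₀ ≤ k → B.relIndex (A ⊓ T k) = B.relIndex A := by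
  classical
  -- finiteness of `A / (B ⊓ A)`
  have hfin : B.relIndex A ≠ 0 := by
    intro h0
    haveI : Infinite (A ⧸ B.addSubgroupOf A) := AddSubgroup.index_eq_zero_iff_infinite.1 h0
    obtain ⟨F, hF⟩ := Infinite.exists_subset_card_eq (A ⧸ B.addSubgroupOf A) (C + 1)
    obtain ⟨k₀, hk₀⟩ := exists_forall_le_subset_range_quotientEmbedding A B T hT hcov F
    have h := card_le_relIndex_inf_of_subset_range A B T F (hk₀ (max k₀ k₁) (le_max_left _ _))
      (hC _ (le_max_right _ _)).1
    have h' := (hC (max k₀ k₁) (le_max_right _ _)).2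
    omega
  haveI : Finite (A ⧸ B.addSubgroupOf A) := by
    by_contra h
    rw [not_finite_iff_infinite] at h
    exact hfin (AddSubgroup.index_eq_zero_iff_infinite.2 h)
  haveI := Fintype.ofFinite (A ⧸ B.addSubgroupOf A)
  obtain ⟨k₀, hk₀⟩ := exists_forall_le_subset_range_quotientEmbedding A B T hT hcov Finset.univ
  have hcard : B.relIndex A = (Finset.univ : Finset (A ⧸ B.addSubgroupOf A)).card := by
    rw [AddSubgroup.relIndex, AddSubgroup.index_eq_card, Nat.card_eq_fintype_card, Finset.card_univ]
  have hge : ∀ k, max k₀ k₁ ≤ k → B.relIndex A ≤ B.relIndex (A ⊓ T k) := fun k hk => by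
    rw [hcard]
    exact card_le_relIndex_inf_of_subset_range A B T Finset.univ (hk₀ k ((le_max_left _ _).trans hk))
      (hC k ((le_max_right _ _).trans hk)).1
  refine ⟨hfin, (hge _ le_rfl).trans (hC _ (le_max_right _ _)).2, max k₀ k₁, fun k hk => le_antisymm ?_ (hge k hk)⟩
  exact AddSubgroup.relIndex_le_of_le_right inf_le_left hfin

end Algebra

/-! ## §2 `[S_Σ : Sel_{p^∞} ⊓ S_Σ]` is finite, reached at a finite level, and `· [Sel^{(p^k)} : H¹_{𝓚⊓ur@Σ}] = ∏ p^{v_p(c_v)}` -/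

section Discrete

variable {K : Type} [Field K] [NumberField K] (W : WeierstrassCurve K) [W.IsElliptic] (p : ℕ) [hp : Fact p.Prime]

omit [NumberField K] in
/-- The images `im ι_k = H¹(K, E[p^∞])[p^k]` increase with `k`. [folklore] -/
theorem monotone_range_map_primaryInclusion :
    Monotone fun k => (galoisCohomology.map (primaryInclusion W p k) 1 : galH1Torsion W ((p ^ k : ℕ) : ℤ) →+ W.galH1Primary p).range := by
  intro k k' hkk' x hx
  refine (mem_range_map_primaryInclusion_iff' W p k' x).2 ?_
  have h := (mem_range_map_primaryInclusion_iff' W p k x).1 hx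
  obtain ⟨d, rfl⟩ := Nat.exists_eq_add_of_le hkk'
  rw [add_comm, pow_add, mul_smul, h, smul_zero]

omit [NumberField K] in
/-- The images `im ι_k` exhaust `H¹(K, E[p^∞])` (every class is `p`-power torsion). [folklore] -/
theorem exists_mem_range_map_primaryInclusion (x : W.galH1Primary p) :
    ∃ k, x ∈ (galoisCohomology.map (primaryInclusion W p k) 1 : galH1Torsion W ((p ^ k : ℕ) : ℤ) →+ W.galH1Primary p).range := by
  obtain ⟨k, hk⟩ := exists_pow_nsmul_eq_zero_of_primary (primaryGaloisModule W p)
    (fun Q ↦ AddCommGroup.mem_primaryComponent.mp Q.2 |>.imp fun k hk ↦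
      Subtype.ext (by rw [AddSubmonoidClass.coe_nsmul, hk, ZeroMemClass.coe_zero])) x
  exact ⟨k, (mem_range_map_primaryInclusion_iff' W p k x).2 hk⟩

omit [W.IsElliptic] hp in
/-- **Kato's `S(T)` as a term, without a definition**: the subgroup `S_Σ ≤ H¹(K, E[p^∞])` cut out by «`p^∞`-Selmer local
kernel at every place off `Σ`, unramified at `Σ`» exists and is unique (an inf of local kernels and of pulled-back unramified
subgroups; consumers obtain the term from this theorem). [cite: Kato2004Asterisque, §14.8 (p. 238)] -/
theorem existsUnique_addSubgroup_mem_iff (Q : Finset (HeightOneSpectrum (𝓞 K))) :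
    ∃! S : AddSubgroup (W.galH1Primary p), ∀ x, x ∈ S ↔
      (∀ v : HeightOneSpectrum (𝓞 K), v ∉ Q → x ∈ selmerLocalKerPrimary W (v.adicCompletion K) p) ∧
      (∀ w : InfinitePlace K, x ∈ selmerLocalKerPrimary W w.Completion p) ∧
      (∀ v ∈ Q, galoisCohomology.localization (primaryGaloisModule W p) (Sum.inr v) 1 x ∈
        unramifiedSubgroup (GaloisRep.toLocal v (primaryGaloisModule W p)) 1) := by
  set S₀ : AddSubgroup (W.galH1Primary p) :=
    (⨅ v : HeightOneSpectrum (𝓞 K), ⨅ (_ : v ∉ Q), selmerLocalKerPrimary W (v.adicCompletion K) p) ⊓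
      ((⨅ w : InfinitePlace K, selmerLocalKerPrimary W w.Completion p) ⊓
        ⨅ v : HeightOneSpectrum (𝓞 K), ⨅ (_ : v ∈ Q),
          AddSubgroup.comap (G := W.galH1Primary p) (galoisCohomology.localization (primaryGaloisModule W p) (Sum.inr v) 1)
            (unramifiedSubgroup (GaloisRep.toLocal v (primaryGaloisModule W p)) 1))
    with hS₀
  have hmem : ∀ x : W.galH1Primary p, x ∈ S₀ ↔
      (∀ v : HeightOneSpectrum (𝓞 K), v ∉ Q → x ∈ selmerLocalKerPrimary W (v.adicCompletion K) p) ∧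
      (∀ w : InfinitePlace K, x ∈ selmerLocalKerPrimary W w.Completion p) ∧
      (∀ v ∈ Q, galoisCohomology.localization (primaryGaloisModule W p) (Sum.inr v) 1 x ∈
        unramifiedSubgroup (GaloisRep.toLocal v (primaryGaloisModule W p)) 1) := by
    intro x
    rw [hS₀]
    change ((x ∈ ⨅ v : HeightOneSpectrum (𝓞 K), ⨅ (_ : v ∉ Q), selmerLocalKerPrimary W (v.adicCompletion K) p) ∧
      (x ∈ ⨅ w : InfinitePlace K, selmerLocalKerPrimary W w.Completion p) ∧
      x ∈ ⨅ v : HeightOneSpectrum (𝓞 K), ⨅ (_ : v ∈ Q),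
          AddSubgroup.comap (G := W.galH1Primary p) (galoisCohomology.localization (primaryGaloisModule W p) (Sum.inr v) 1)
            (unramifiedSubgroup (GaloisRep.toLocal v (primaryGaloisModule W p)) 1)) ↔ _
    simp only [AddSubgroup.mem_iInf, AddSubgroup.mem_comap]
    exact Iff.rfl
  exact ⟨S₀, hmem, fun S' hS' => AddSubgroup.ext fun x => (hS' x).trans (hmem x).symm⟩

/-- **At an additive `v ∤ p`, `p` odd, the `p^∞`-Selmer local kernel is unramified**: `x ∈ Sel-loc_v(E[p^∞]) ⟹ loc_v x ∈
H¹_ur(K_v, E[p^∞])` (write `x = ι_{k+1} y`; `y` is Kummer at `v`, and Part 26's door at level `p^{k+1}`).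
[cite: GreenbergLNM1716, §2 (pp. 72–74)] [cite: MilneADT2006, Ch. I, Prop. 3.8] -/
theorem localization_mem_unramifiedSubgroup_of_mem_selmerLocalKerPrimary (hodd : p ≠ 2)
    (v : HeightOneSpectrum (𝓞 K)) (hpv : ((p : ℕ) : 𝓞 K) ∉ v.asIdeal) (hadd : W.HasAdditiveReductionAt v)
    (x : W.galH1Primary p) (hx : x ∈ selmerLocalKerPrimary W (v.adicCompletion K) p) :
    galoisCohomology.localization (primaryGaloisModule W p) (Sum.inr v) 1 x ∈
      unramifiedSubgroup (GaloisRep.toLocal v (primaryGaloisModule W p)) 1 := by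
  obtain ⟨k, hk⟩ := exists_mem_range_map_primaryInclusion W p x
  obtain ⟨y, rfl⟩ := monotone_range_map_primaryInclusion W p (Nat.le_succ k) hk
  have hI : ∀ X : W.geomPrimaryTorsion p,
      (∀ τ ∈ absInertia (v.adicCompletion K),
        GaloisRep.restrictField (v.adicCompletion K) (primaryGaloisModule W p) τ X = X) → p ^ (k + 1) • X = 0 :=
    fun X hX => by rw [pow_succ, mul_smul, inertia_torsion_of_hasAdditiveReductionAt W p v hpv hodd hadd X hX, smul_zero]
  have hy : y ∈ selmerLocalKer W (v.adicCompletion K) ((p ^ (k + 1) : ℕ) : ℤ) :=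
    (map_primaryInclusion_mem_selmerLocalKerPrimary_iff W p (k + 1) _ y).1 hx
  have hloc : galoisCohomology.localization (W.torsionGaloisModule ((p ^ (k + 1) : ℕ) : ℤ)) (Sum.inr v) 1 y ∈
      W.kummerSelmerStructure ((p ^ (k + 1) : ℕ) : ℤ) (Sum.inr v) :=
    AddSubgroup.mem_comap.1
      ((SetLike.ext_iff.mp (W.comap_localization_kummerSelmerStructure ((p ^ (k + 1) : ℕ) : ℤ) (Sum.inr v)) y).2 hy)
  exact (localization_mem_kummer_sup_unramified_iff W p (k + 1) v hpv hI y).1 (AddSubgroup.mem_sup_left hloc)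

/-- **`Sel_{p^∞}(E/K) ≤ S_Σ`** when every `v ∈ Σ` is additive with `v ∤ p` and `p` is odd (so the index of Part 27 is
`[S_Σ : Sel_{p^∞}(E/K)]`). [cite: Kato2004Asterisque, §14.8 (p. 238)] -/
theorem selmerGroupPInfty_le_of_mem_iff (hodd : p ≠ 2) (Q : Finset (HeightOneSpectrum (𝓞 K)))
    (hQp : ∀ v ∈ Q, ((p : ℕ) : 𝓞 K) ∉ v.asIdeal) (hQadd : ∀ v ∈ Q, W.HasAdditiveReductionAt v)
    (S : AddSubgroup (W.galH1Primary p))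
    (hS : ∀ x, x ∈ S ↔
      (∀ v : HeightOneSpectrum (𝓞 K), v ∉ Q → x ∈ selmerLocalKerPrimary W (v.adicCompletion K) p) ∧
      (∀ w : InfinitePlace K, x ∈ selmerLocalKerPrimary W w.Completion p) ∧
      (∀ v ∈ Q, galoisCohomology.localization (primaryGaloisModule W p) (Sum.inr v) 1 x ∈
        unramifiedSubgroup (GaloisRep.toLocal v (primaryGaloisModule W p)) 1)) :
    selmerGroupPInfty W p ≤ S := by
  intro x hx
  have hx' : (x ∈ ⨅ v : HeightOneSpectrum (𝓞 K), selmerLocalKerPrimary W (v.adicCompletion K) p) ∧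
      x ∈ ⨅ w : InfinitePlace K, selmerLocalKerPrimary W w.Completion p := hx
  rw [AddSubgroup.mem_iInf, AddSubgroup.mem_iInf] at hx'
  exact (hS x).2 ⟨fun v _ => hx'.1 v, hx'.2, fun v hv =>
    localization_mem_unramifiedSubgroup_of_mem_selmerLocalKerPrimary W p hodd v (hQp v hv) (hQadd v hv) x (hx'.1 v)⟩

/-- **(R1-d), discrete side: the index `[S_Σ : Sel_{p^∞} ⊓ S_Σ]` is finite, is reached at a finite level, and
`[S_Σ : Sel_{p^∞} ⊓ S_Σ] · [Sel^{(p^k)}(E/K) : H¹_{𝓚⊓ur@Σ}(K, E[p^k])] = ∏_{v∈Σ} p^{v_p(c_v)}` for all large `k`.**  Hypotheses as in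
Part 26's `exists_forall_le_relIndex_selmerGroupPInfty_mul_relIndex_eq` (`K : Type`, `p` odd, `Σ ⊆ T`, every `v ∈ Σ` additive
with `v ∤ p`, `T ⊇ {v ∣ p} ∪ {bad}`, `S_Σ` cut out by «`p^∞`-Selmer local kernel off `Σ`, unramified at `Σ`»); conclusion for all
Selmer structures `𝓖'` on `E[p^k]` of the shape «`𝓚 ⊓ H¹_ur` at `Σ`, `𝓚` at every other place».  The second factor is thus
independent of `k ≫ 0` (the memo's `p^a`, compact side, not identified here).
[cite: Rubin2000, Thm. 1.7.3] [cite: Kato2004Asterisque, §14.8 (p. 238) and (14.9.3) (p. 240)] [cite: GreenbergLNM1716, §5 (p. 114)] -/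
theorem exists_forall_le_relIndex_selmerGroupPInfty_eq_and_mul_eq (hodd : p ≠ 2)
    (Q T : Finset (HeightOneSpectrum (𝓞 K))) (hQT : Q ⊆ T)
    (hQp : ∀ v ∈ Q, ((p : ℕ) : 𝓞 K) ∉ v.asIdeal) (hQadd : ∀ v ∈ Q, W.HasAdditiveReductionAt v)
    (hTp : ∀ v : HeightOneSpectrum (𝓞 K), ((p : ℕ) : 𝓞 K) ∈ v.asIdeal → v ∈ T)
    (hTbad : ∀ v : HeightOneSpectrum (𝓞 K), ¬ W.HasGoodReductionAt v → v ∈ T)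
    (S : AddSubgroup (W.galH1Primary p))
    (hS : ∀ x, x ∈ S ↔
      (∀ v : HeightOneSpectrum (𝓞 K), v ∉ Q → x ∈ selmerLocalKerPrimary W (v.adicCompletion K) p) ∧
      (∀ w : InfinitePlace K, x ∈ selmerLocalKerPrimary W w.Completion p) ∧
      (∀ v ∈ Q, galoisCohomology.localization (primaryGaloisModule W p) (Sum.inr v) 1 x ∈
        unramifiedSubgroup (GaloisRep.toLocal v (primaryGaloisModule W p)) 1)) :
    (selmerGroupPInfty W p).relIndex S ≠ 0 ∧
    (selmerGroupPInfty W p).relIndex S ≤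
      ∏ v ∈ Q, p ^ padicValNat p ((W.baseChange (v.adicCompletion K)).localTamagawaNumber (v.adicCompletionIntegers K)) ∧
    ∃ k₀ : ℕ, 1 ≤ k₀ ∧ ∀ k, k₀ ≤ k →
      (selmerGroupPInfty W p).relIndex (S ⊓ (galoisCohomology.map (primaryInclusion W p k) 1 : galH1Torsion W ((p ^ k : ℕ) : ℤ) →+ W.galH1Primary p).range) =
        (selmerGroupPInfty W p).relIndex S ∧
      ∀ (𝓖' : SelmerStructure (W.torsionGaloisModule ((p ^ k : ℕ) : ℤ))),
        (∀ v ∈ Q, 𝓖' (Sum.inr v) = W.kummerSelmerStructure ((p ^ k : ℕ) : ℤ) (Sum.inr v) ⊓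
          unramifiedSubgroup (GaloisRep.toLocal v (W.torsionGaloisModule ((p ^ k : ℕ) : ℤ))) 1) →
        (∀ v ∉ Q, 𝓖' (Sum.inr v) = W.kummerSelmerStructure ((p ^ k : ℕ) : ℤ) (Sum.inr v)) →
        (∀ w : InfinitePlace K, 𝓖' (Sum.inl w) = W.kummerSelmerStructure ((p ^ k : ℕ) : ℤ) (Sum.inl w)) →
        (selmerGroupPInfty W p).relIndex S *
            𝓖'.selmerGroup.relIndex (W.kummerSelmerStructure ((p ^ k : ℕ) : ℤ)).selmerGroup =
          ∏ v ∈ Q, p ^ padicValNat p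
            ((W.baseChange (v.adicCompletion K)).localTamagawaNumber (v.adicCompletionIntegers K)) := by
  classical
  set C := ∏ v ∈ Q, p ^ padicValNat p
    ((W.baseChange (v.adicCompletion K)).localTamagawaNumber (v.adicCompletionIntegers K)) with hCdef
  have hCpos : 0 < C := Finset.prod_pos fun v _ => pow_pos hp.out.pos _
  obtain ⟨k₁, hk₁, h⟩ := exists_forall_le_relIndex_selmerGroupPInfty_mul_relIndex_eq W p hodd Q T hQT hQp hQadd hTp hTbad
    S hS
  -- the two canonical structures at level `p^k`
  let 𝓖₀ : ∀ k : ℕ, SelmerStructure (W.torsionGaloisModule ((p ^ k : ℕ) : ℤ)) := fun k u =>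
    match u with
    | Sum.inl w => W.kummerSelmerStructure ((p ^ k : ℕ) : ℤ) (Sum.inl w)
    | Sum.inr v => if v ∈ Q then W.kummerSelmerStructure ((p ^ k : ℕ) : ℤ) (Sum.inr v) ⊔
        unramifiedSubgroup (GaloisRep.toLocal v (W.torsionGaloisModule ((p ^ k : ℕ) : ℤ))) 1
        else W.kummerSelmerStructure ((p ^ k : ℕ) : ℤ) (Sum.inr v)
  let 𝓖₀' : ∀ k : ℕ, SelmerStructure (W.torsionGaloisModule ((p ^ k : ℕ) : ℤ)) := fun k u =>
    match u with
    | Sum.inl w => W.kummerSelmerStructure ((p ^ k : ℕ) : ℤ) (Sum.inl w)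
    | Sum.inr v => if v ∈ Q then W.kummerSelmerStructure ((p ^ k : ℕ) : ℤ) (Sum.inr v) ⊓
        unramifiedSubgroup (GaloisRep.toLocal v (W.torsionGaloisModule ((p ^ k : ℕ) : ℤ))) 1
        else W.kummerSelmerStructure ((p ^ k : ℕ) : ℤ) (Sum.inr v)
  have h𝓖₀Q : ∀ k, ∀ v ∈ Q, 𝓖₀ k (Sum.inr v) = W.kummerSelmerStructure ((p ^ k : ℕ) : ℤ) (Sum.inr v) ⊔
      unramifiedSubgroup (GaloisRep.toLocal v (W.torsionGaloisModule ((p ^ k : ℕ) : ℤ))) 1 := fun k v hv => by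
    change (if v ∈ Q then _ else _) = _; rw [if_pos hv]
  have h𝓖₀nQ : ∀ k, ∀ v ∉ Q, 𝓖₀ k (Sum.inr v) = W.kummerSelmerStructure ((p ^ k : ℕ) : ℤ) (Sum.inr v) :=
    fun k v hv => by change (if v ∈ Q then _ else _) = _; rw [if_neg hv]
  have h𝓖₀'Q : ∀ k, ∀ v ∈ Q, 𝓖₀' k (Sum.inr v) = W.kummerSelmerStructure ((p ^ k : ℕ) : ℤ) (Sum.inr v) ⊓
      unramifiedSubgroup (GaloisRep.toLocal v (W.torsionGaloisModule ((p ^ k : ℕ) : ℤ))) 1 := fun k v hv => by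
    change (if v ∈ Q then _ else _) = _; rw [if_pos hv]
  have h𝓖₀'nQ : ∀ k, ∀ v ∉ Q, 𝓖₀' k (Sum.inr v) = W.kummerSelmerStructure ((p ^ k : ℕ) : ℤ) (Sum.inr v) :=
    fun k v hv => by change (if v ∈ Q then _ else _) = _; rw [if_neg hv]
  -- the bound `[S ⊓ im ι_k : Sel_{p^∞} ⊓ …] ∣ C` for `k ≥ k₁`
  have hbound : ∀ k, k₁ ≤ k →
      (selmerGroupPInfty W p).relIndex (S ⊓ (galoisCohomology.map (primaryInclusion W p k) 1 : galH1Torsion W ((p ^ k : ℕ) : ℤ) →+ W.galH1Primary p).range) ≠ 0 ∧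
      (selmerGroupPInfty W p).relIndex (S ⊓ (galoisCohomology.map (primaryInclusion W p k) 1 : galH1Torsion W ((p ^ k : ℕ) : ℤ) →+ W.galH1Primary p).range) ≤ C := by
    intro k hk
    obtain ⟨-, hmul⟩ := h k hk (𝓖₀ k) (𝓖₀' k) (h𝓖₀Q k) (h𝓖₀nQ k) (fun w => rfl) (h𝓖₀'Q k) (h𝓖₀'nQ k) (fun w => rfl)
    have hdvd : (selmerGroupPInfty W p).relIndex (S ⊓ (galoisCohomology.map (primaryInclusion W p k) 1 : galH1Torsion W ((p ^ k : ℕ) : ℤ) →+ W.galH1Primary p).range) ∣ C :=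
      Dvd.intro _ hmul
    refine ⟨fun h0 => ?_, Nat.le_of_dvd hCpos hdvd⟩
    rw [h0, zero_mul] at hmul
    exact hCpos.ne' hmul.symm
  obtain ⟨hne, hle, k₂, hk₂⟩ := relIndex_ne_zero_and_exists_forall_le_relIndex_inf_eq S (selmerGroupPInfty W p)
    (fun k => (galoisCohomology.map (primaryInclusion W p k) 1 : galH1Torsion W ((p ^ k : ℕ) : ℤ) →+ W.galH1Primary p).range) (monotone_range_map_primaryInclusion W p)
    (exists_mem_range_map_primaryInclusion W p) C k₁ hbound
  refine ⟨hne, hle, max k₁ k₂, le_trans hk₁ (le_max_left _ _), fun k hk => ⟨hk₂ k ((le_max_right _ _).trans hk), ?_⟩⟩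
  intro 𝓖' h𝓖'Q h𝓖'nQ h𝓖'inl
  obtain ⟨-, hmul⟩ := h k ((le_max_left _ _).trans hk) (𝓖₀ k) 𝓖' (h𝓖₀Q k) (h𝓖₀nQ k) (fun w => rfl) h𝓖'Q h𝓖'nQ
    h𝓖'inl
  rw [← hk₂ k ((le_max_right _ _).trans hk)]
  exact hmul

/-- **(R1-d), DISCRETE SIDE, SELF-CONTAINED** (no free `S`): for `K : Type`, `p` odd, `Σ ⊆ T` (every `v ∈ Σ` additive with
`v ∤ p`; `T ⊇ {v ∣ p} ∪ {bad}`) there is a subgroup `S_Σ ≤ H¹(K, E[p^∞])` — THE one cut out by «`p^∞`-Selmer local kernel off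
`Σ`, unramified at `Σ`» (Kato's `S(T)` over `ℚ`) — with `Sel_{p^∞}(E/K) ≤ S_Σ`, `[S_Σ : Sel_{p^∞}(E/K)]` finite, and
`∃ k₀ ≥ 1, ∀ k ≥ k₀`, for every Selmer structure `𝓖'` on `E[p^k]` of the shape «`𝓚 ⊓ H¹_ur` at `Σ`, `𝓚` elsewhere»:
**`[S_Σ : Sel_{p^∞}(E/K)] · [Sel^{(p^k)}(E/K) : H¹_{𝓖'}(K, E[p^k])] = ∏_{v∈Σ} p^{v_p(c_v)}`.**  The potss memo's (R1-d) reads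
`#(S(T)/Sel_{p^∞}) · p^a = C′`; the identification of the (eventually constant) second factor with `p^a = [ℤ_pκ_∞(P) : 𝔥]`
(Parts 19–21, the COMPACT side) is NOT done here.
[cite: Kato2004Asterisque, §14.8 (p. 238) and (14.9.3) (p. 240)] [cite: Rubin2000, Thm. 1.7.3] [cite: GreenbergLNM1716, §5 (p. 114)] -/
theorem exists_addSubgroup_selmerGroupPInfty_le_and_relIndex_mul_eq (hodd : p ≠ 2)
    (Q T : Finset (HeightOneSpectrum (𝓞 K))) (hQT : Q ⊆ T)
    (hQp : ∀ v ∈ Q, ((p : ℕ) : 𝓞 K) ∉ v.asIdeal) (hQadd : ∀ v ∈ Q, W.HasAdditiveReductionAt v)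
    (hTp : ∀ v : HeightOneSpectrum (𝓞 K), ((p : ℕ) : 𝓞 K) ∈ v.asIdeal → v ∈ T)
    (hTbad : ∀ v : HeightOneSpectrum (𝓞 K), ¬ W.HasGoodReductionAt v → v ∈ T) :
    ∃ S : AddSubgroup (W.galH1Primary p),
      (∀ x, x ∈ S ↔
        (∀ v : HeightOneSpectrum (𝓞 K), v ∉ Q → x ∈ selmerLocalKerPrimary W (v.adicCompletion K) p) ∧
        (∀ w : InfinitePlace K, x ∈ selmerLocalKerPrimary W w.Completion p) ∧
        (∀ v ∈ Q, galoisCohomology.localization (primaryGaloisModule W p) (Sum.inr v) 1 x ∈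
          unramifiedSubgroup (GaloisRep.toLocal v (primaryGaloisModule W p)) 1)) ∧
      selmerGroupPInfty W p ≤ S ∧ (selmerGroupPInfty W p).relIndex S ≠ 0 ∧
      ∃ k₀ : ℕ, 1 ≤ k₀ ∧ ∀ k, k₀ ≤ k →
        ∀ (𝓖' : SelmerStructure (W.torsionGaloisModule ((p ^ k : ℕ) : ℤ))),
          (∀ v ∈ Q, 𝓖' (Sum.inr v) = W.kummerSelmerStructure ((p ^ k : ℕ) : ℤ) (Sum.inr v) ⊓
            unramifiedSubgroup (GaloisRep.toLocal v (W.torsionGaloisModule ((p ^ k : ℕ) : ℤ))) 1) →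
          (∀ v ∉ Q, 𝓖' (Sum.inr v) = W.kummerSelmerStructure ((p ^ k : ℕ) : ℤ) (Sum.inr v)) →
          (∀ w : InfinitePlace K, 𝓖' (Sum.inl w) = W.kummerSelmerStructure ((p ^ k : ℕ) : ℤ) (Sum.inl w)) →
          (selmerGroupPInfty W p).relIndex S *
              𝓖'.selmerGroup.relIndex (W.kummerSelmerStructure ((p ^ k : ℕ) : ℤ)).selmerGroup =
            ∏ v ∈ Q, p ^ padicValNat p
              ((W.baseChange (v.adicCompletion K)).localTamagawaNumber (v.adicCompletionIntegers K)) := by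
  obtain ⟨S, hS, -⟩ := existsUnique_addSubgroup_mem_iff W p Q
  obtain ⟨hne, -, k₀, hk₀, h⟩ :=
    exists_forall_le_relIndex_selmerGroupPInfty_eq_and_mul_eq W p hodd Q T hQT hQp hQadd hTp hTbad S hS
  exact ⟨S, hS, selmerGroupPInfty_le_of_mem_iff W p hodd Q hQp hQadd S hS, hne, k₀, hk₀,
    fun k hk 𝓖' h₁ h₂ h₃ => (h k hk).2 𝓖' h₁ h₂ h₃⟩

end Discrete

end Summit.BirchSwinnertonDyer.Rank1Residual.Additive.KummerUnramified

end
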